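import Summits.PneNP.PneNP.Theorems.SymmetryBudgetNoHiddenOrderProgramSrcsB
import Summits.PneNP.PneNP.Theorems.SymmetryBudgetNoHiddenOrderProgramSrcsASym
import Summits.PneNP.PneNP.Theorems.SymmetryBudgetNoHiddenOrderProgramSymKit

/-!
# `NoHiddenOrder` (stmt-PneNP-14781), (R2c) VI: the window canoniser program — source equivariance of the walk shapes

Route `PneNP/SymmetryBudget`; companion of `…ProgramSrcsB.lean` (seat -1) in the style of `…ProgramSrcsASym.lean`: the `srcs_eq` half of
`SymProg.IsSym` for the analysis shape `AnGate` and the transition shape `TrGate`, PARAMETRIC in the wire map `F`, the permutation `σ` of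
the window type, the label `L ↦ FLab.relabel σ L`, the input records `ι ↦ ι'` (`AnIn`) and the embeddings:
`anSrcs_image`, `trSrcs_image` (with `trRIIn` handled through `riSrcs_image`), the kinds `anKind_relabel`, `trKind_relabel`; and the
STATE WIRES of the walk under `Sum.map π (Gt.perm ρ σ)`: `map_memW`, `map_valW`, `map_consW`, `map_deadW`, `map_adjWire'`, whence the
dispatched instances `anSrcs_stIn_image` / `trSrcs_stIn_image` for the expected dispatch `srcs (.an L k g) = anSrcs L (stIn L k) (.an L k) g`,
`srcs (.tr L k g) = trSrcs L (stIn L k.castSucc) (.an L k.castSucc) (.tr L k) g`.  Label data move as `lU (σ·L) = fs σ (lU L)`,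
`lX (σ·L) = fs σ (lX L)`, `lLam (σ·L) v = lLam L (σ⁻¹ v)` (all `rfl`).  Sorry-free; supports stmt-PneNP-14781, does not close it.
-/

set_option linter.dupNamespace false -- `Summit.PneNP.PneNP.…` (D-0017 single-conjunct layout)

namespace Summit.PneNP.PneNP.Theorems

open Finset CGBits BranchSum Literature.Computability.Complexity Literature.Computability.Complexity.SymProg

namespace WCanon

variable {m : ℕ}

/-! ### Label data under relabelling -/

/-- The block of a relabelled label. [folklore] -/
@[simp] theorem lU_relabel (σ : Equiv.Perm (WV m)) (L : FLab m) : lU (FLab.relabel σ L) = fs σ (lU L) := rfl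

/-- The consumed points of a relabelled label. [folklore] -/
@[simp] theorem lX_relabel (σ : Equiv.Perm (WV m)) (L : FLab m) : lX (FLab.relabel σ L) = fs σ (lX L) := rfl

/-- The multiplicities of a relabelled label. [folklore] -/
@[simp] theorem lLam_relabel (σ : Equiv.Perm (WV m)) (L : FLab m) (v : WV m) : lLam (FLab.relabel σ L) v = lLam L (σ.symm v) := rfl

/-- The image of an image over all PAIRS of window vertices, reindexed. [folklore] -/
theorem image_image_univ_pair {β γ : Type*} [DecidableEq β] [DecidableEq γ] (σ : Equiv.Perm (WV m)) (f : WV m × WV m → β) (F : β → γ)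
    (f' : WV m × WV m → γ) (h : ∀ ab, F (f ab) = f' (σ ab.1, σ ab.2)) : (univ.image f).image F = univ.image f' := by
  rw [image_image_map_equiv (σ.prodCongr σ) univ f F f' (fun ab => h ab), Finset.map_univ_equiv]

/-! ### The analysis shape -/

/-- **The kind of the analysis shape is invariant.** [folklore] -/
theorem anKind_relabel (σ : Equiv.Perm (WV m)) (L : FLab m) (g : AnGate m) :
    anKind (FLab.relabel σ L) (g.relabel σ) = anKind L g := by
  cases g <;> simp [anKind, AnGate.relabel, EmbeddingLike.apply_eq_iff_eq]

section An

variable (F : Wire m → Wire m) (σ : Equiv.Perm (WV m)) (L : FLab m) (ι ι' : AnIn m) (e e' : AnGate m → Gt m)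
  (he : ∀ g, F (Sum.inr (e g)) = Sum.inr (e' (g.relabel σ)))
  (hmem : ∀ v, F (ι.mem v) = ι'.mem (σ v)) (hval : ∀ v c, F (ι.val v c) = ι'.val (σ v) c)
  (hcons : ∀ v, F (ι.cons v) = ι'.cons (σ v)) (hdead : F ι.dead = ι'.dead) (hadj : ∀ u v, F (ι.adj u v) = ι'.adj (σ u) (σ v))
include he hmem hval hcons hdead hadj

/-- **Source equivariance of the analysis shape.** [folklore] -/
theorem anSrcs_image (g : AnGate m) : (anSrcs L ι e g).image F = anSrcs (FLab.relabel σ L) ι' e' (g.relabel σ) := by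
  cases g with
  | oPr u v c c' => simp only [anSrcs, AnGate.relabel, image_insert, image_singleton, hval]
  | oLt u v =>
    simp only [anSrcs, AnGate.relabel]
    exact image_image_congr _ _ F _ (fun cc => he _)
  | oEq u v =>
    simp only [anSrcs, AnGate.relabel]
    exact image_image_congr _ _ F _ (fun c => he _)
  | swPr u v a b => simp only [anSrcs, AnGate.relabel, image_insert, image_singleton, hmem, he]
  | swApr u v a b => simp only [anSrcs, AnGate.relabel, image_insert, image_singleton, hadj, he]
  | swTw u v g =>
    simp only [anSrcs, AnGate.relabel]
    rw [ctSrcs_image F _ _ (fun g' => e (.swTw u v g')) (fun g' => e' (.swTw (σ u) (σ v) g')) (fun g' => he _)]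
    rw [image_image_univ_pair σ _ F (fun ab => Sum.inr (e' (.swPr (σ u) (σ v) ab.1 ab.2))) (fun ab => he _),
      image_image_univ_pair σ _ F (fun ab => Sum.inr (e' (.swApr (σ u) (σ v) ab.1 ab.2))) (fun ab => he _)]
  | swNadj u v => simp only [anSrcs, AnGate.relabel, image_singleton, hadj]
  | swNtw u v => simp only [anSrcs, AnGate.relabel, image_singleton, he]
  | swKept u v => simp only [anSrcs, AnGate.relabel, image_insert, image_singleton, hadj, he]
  | swAdded u v => simp only [anSrcs, AnGate.relabel, image_insert, image_singleton, he]
  | swSw' u v => simp only [anSrcs, AnGate.relabel, image_insert, image_singleton, he]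
  | swSw u v =>
    simp only [anSrcs, AnGate.relabel, EmbeddingLike.apply_eq_iff_eq]
    split_ifs
    · rfl
    · simp only [image_insert, image_singleton, hmem, he, AnGate.relabel]
  | rE u v => simp only [anSrcs, AnGate.relabel, image_insert, image_singleton, hmem, he]
  | rMid i u w v => simp only [anSrcs, AnGate.relabel, image_insert, image_singleton, he]
  | rR i u v =>
    simp only [anSrcs, AnGate.relabel, EmbeddingLike.apply_eq_iff_eq]
    by_cases hi : (i : ℕ) = 0
    · rw [dif_pos hi, dif_pos hi]
      split_ifs
      · simp only [image_singleton, hmem]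
      · rfl
    · rw [dif_neg hi, dif_neg hi, image_insert, he]
      congr 1
      exact image_image_univ_equiv σ _ F _ (fun w => he _)
  | mcCy u y => simp only [anSrcs, AnGate.relabel, image_insert, image_singleton, hmem, he]
  | mcBig u =>
    simp only [anSrcs, AnGate.relabel]
    exact image_image_univ_equiv σ _ F _ (fun y => he _)
  | mcCmp v u g =>
    simp only [anSrcs, AnGate.relabel]
    rw [ccSrcs_image F _ _ (fun g' => e (.mcCmp v u g')) (fun g' => e' (.mcCmp (σ v) (σ u) g')) (fun g' => he _)]
    rw [image_image_univ_equiv σ _ F (fun y => Sum.inr (e' (.mcCy (σ v) y))) (fun y => he _),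
      image_image_univ_equiv σ _ F (fun y => Sum.inr (e' (.mcCy (σ u) y))) (fun y => he _)]
  | mcTieLT v u => simp only [anSrcs, AnGate.relabel, image_insert, image_singleton, he]
  | mcBo v u => simp only [anSrcs, AnGate.relabel, image_insert, image_singleton, he]
  | mcBetter v u => simp only [anSrcs, AnGate.relabel, image_insert, image_singleton, hmem, he]
  | mcNobetter u =>
    simp only [anSrcs, AnGate.relabel]
    exact image_image_univ_equiv σ _ F _ (fun v => he _)
  | mcSel u => simp only [anSrcs, AnGate.relabel, image_insert, image_singleton, hmem, he]
  | nmem v => simp only [anSrcs, AnGate.relabel, image_singleton, hmem]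
  | ncons v => simp only [anSrcs, AnGate.relabel, image_singleton, hcons]
  | cov u w => simp only [anSrcs, AnGate.relabel, image_insert, image_singleton, he]
  | all u =>
    simp only [anSrcs, AnGate.relabel]
    exact image_image_univ_equiv σ _ F _ (fun w => he _)
  | nall u => simp only [anSrcs, AnGate.relabel, image_singleton, he]
  | disc u => simp only [anSrcs, AnGate.relabel, image_insert, image_singleton, hmem, he]
  | isAND =>
    simp only [anSrcs, AnGate.relabel]
    exact image_image_univ_equiv σ _ F _ (fun u => he _)
  | nisAND => simp only [anSrcs, AnGate.relabel, image_singleton, he]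
  | big2 =>
    simp only [anSrcs, AnGate.relabel]
    exact image_image_univ_equiv σ _ F _ (fun v => hmem v)
  | nbig2 => simp only [anSrcs, AnGate.relabel, image_singleton, he]
  | isOR => simp only [anSrcs, AnGate.relabel, image_insert, image_singleton, he]
  | stop =>
    simp only [anSrcs, AnGate.relabel, image_union, lU_relabel, lX_relabel]
    rw [image_image_fs σ (lU L) ι.mem F ι'.mem hmem, image_image_fs σ (lX L) ι.cons F ι'.cons hcons,
      image_image_fs σ (univ \ lU L) _ F (fun v => Sum.inr (e' (.nmem v))) (fun v => he _),
      image_image_fs σ (univ \ lX L) _ F (fun v => Sum.inr (e' (.ncons v))) (fun v => he _),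
      fs_sdiff, fs_sdiff, fs_univ]
  | frozen => simp only [anSrcs, AnGate.relabel, image_insert, image_singleton, hdead, he]
  | nfrozen => simp only [anSrcs, AnGate.relabel, image_singleton, he]
  | cand y =>
    simp only [anSrcs, AnGate.relabel, lX_relabel, mem_fs]
    split_ifs
    · simp only [image_insert, image_singleton, hmem, he, AnGate.relabel]
    · rfl
  | ncand y => simp only [anSrcs, AnGate.relabel, image_singleton, he]
  | dom y =>
    simp only [anSrcs, AnGate.relabel, lX_relabel, lLam_relabel, Equiv.symm_apply_apply, image_insert, he]
    congr 1
    rw [image_image_map_equiv σ _ _ F (fun z => Sum.inr (e' (.ncand z))) (fun z => he _)]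
    congr 1
    change fs σ _ = _
    rw [fs_filter]
    refine Finset.filter_congr fun z _ => ?_
    simp only [ne_eq, Equiv.symm_apply_eq]
  | ndom y => simp only [anSrcs, AnGate.relabel, image_singleton, he]
  | go =>
    simp only [anSrcs, AnGate.relabel, lX_relabel]
    exact image_image_fs σ (lX L) _ F _ (fun y => he _)
  | ngo => simp only [anSrcs, AnGate.relabel, image_singleton, he]
  | andok =>
    simp only [anSrcs, AnGate.relabel, lU_relabel, fs_nonempty_iff]
    split_ifs
    · exact image_image_fs_product σ (lU L) (lU L) _ F _ (fun a b => he _)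
    · rfl
  | nandok => simp only [anSrcs, AnGate.relabel, image_singleton, he]

end An

/-! ### The transition shape -/

/-- **The kind of the transition shape is invariant.** [folklore] -/
theorem trKind_relabel (σ : Equiv.Perm (WV m)) (g : TrGate m) : trKind (g.relabel σ) = trKind g := by
  cases g <;> simp [trKind, TrGate.relabel, riKind_relabel]

section Tr

variable (F : Wire m → Wire m) (σ : Equiv.Perm (WV m)) (L : FLab m) (ι ι' : AnIn m) (ea ea' : AnGate m → Gt m)
  (e e' : TrGate m → Gt m)
  (hea : ∀ g, F (Sum.inr (ea g)) = Sum.inr (ea' (g.relabel σ))) (he : ∀ g, F (Sum.inr (e g)) = Sum.inr (e' (g.relabel σ)))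
  (hmem : ∀ v, F (ι.mem v) = ι'.mem (σ v)) (hval : ∀ v c, F (ι.val v c) = ι'.val (σ v) c)
  (hcons : ∀ v, F (ι.cons v) = ι'.cons (σ v)) (hdead : F ι.dead = ι'.dead) (hadj : ∀ u v, F (ι.adj u v) = ι'.adj (σ u) (σ v))
include hea he hmem hval hcons hdead hadj

/-- **Source equivariance of the transition shape.** [folklore] -/
theorem trSrcs_image (g : TrGate m) :
    (trSrcs L ι ea e g).image F = trSrcs (FLab.relabel σ L) ι' ea' e' (g.relabel σ) := by
  cases g with
  | tieD u v => simp only [trSrcs, TrGate.relabel, image_insert, image_singleton, hea]; rfl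
  | ltI u v => simp only [trSrcs, TrGate.relabel, image_insert, image_singleton, hea, he]; rfl
  | bothD u v => simp only [trSrcs, TrGate.relabel, image_insert, image_singleton, hea]; rfl
  | noneD u v => simp only [trSrcs, TrGate.relabel, image_insert, image_singleton, hea]; rfl
  | deqv u v => simp only [trSrcs, TrGate.relabel, image_insert, image_singleton, he]
  | eqI u v => simp only [trSrcs, TrGate.relabel, image_insert, image_singleton, hea, he]; rfl
  | rv g =>
    simp only [trSrcs, TrGate.relabel]
    exact riSrcs_image F σ (trRIIn ι e) (trRIIn ι' e') (fun g' => e (.rv g')) (fun g' => e' (.rv g')) (fun g' => he _)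
      hmem hadj (fun u v => he _) (fun u v => he _) g
  | takeAnd => simp only [trSrcs, TrGate.relabel, image_insert, image_singleton, hea]; rfl
  | ntakeAnd => simp only [trSrcs, TrGate.relabel, image_singleton, he]
  | takeOr => simp only [trSrcs, TrGate.relabel, image_insert, image_singleton, hea]; rfl
  | ntakeOr => simp only [trSrcs, TrGate.relabel, image_singleton, he]
  | newMem w =>
    simp only [trSrcs, TrGate.relabel, lU_relabel]
    exact image_image_fs σ (lU L) _ F _ (fun u => hea _)
  | m1 v => simp only [trSrcs, TrGate.relabel, image_insert, image_singleton, hmem, he]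
  | m2 v => simp only [trSrcs, TrGate.relabel, image_insert, image_singleton, he]
  | mx v => simp only [trSrcs, TrGate.relabel, image_insert, image_singleton, he]
  | v1 v c => simp only [trSrcs, TrGate.relabel, image_insert, image_singleton, he]; rfl
  | v2 v c => simp only [trSrcs, TrGate.relabel, image_insert, image_singleton, hval, he]
  | vx v c => simp only [trSrcs, TrGate.relabel, image_insert, image_singleton, he]
  | c1 v => simp only [trSrcs, TrGate.relabel, image_insert, image_singleton, hea, he]; rfl
  | cx v => simp only [trSrcs, TrGate.relabel, image_insert, image_singleton, hcons, he]
  | d1 => simp only [trSrcs, TrGate.relabel, image_insert, image_singleton, hea]; rfl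
  | d2 => simp only [trSrcs, TrGate.relabel, image_insert, image_singleton, hea]; rfl
  | d3 => simp only [trSrcs, TrGate.relabel, image_insert, image_singleton, hea]; rfl
  | dx => simp only [trSrcs, TrGate.relabel, image_insert, image_singleton, hdead, he]

end Tr

/-! ### The state wires under `Gt.perm` -/

section State

variable (π : Fin m × Fin m → Fin m × Fin m) (ρ : Equiv.Perm (Fin m)) (σ : Equiv.Perm (WV m))

/-- The membership wires are equivariant. [folklore] -/
theorem map_memW (L : FLab m) (k : Fin (pF m + 1)) (v : WV m) :
    Sum.map π (Gt.perm ρ σ) (memW L k v) = memW (FLab.relabel σ L) k (σ v) := by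
  unfold memW; split_ifs <;> rfl

/-- The value wires are equivariant. [folklore] -/
theorem map_valW (L : FLab m) (k : Fin (pF m + 1)) (v : WV m) (c : Fin (wn m)) :
    Sum.map π (Gt.perm ρ σ) (valW L k v c) = valW (FLab.relabel σ L) k (σ v) c := by
  unfold valW; split_ifs <;> rfl

/-- The consumed wires are equivariant. [folklore] -/
theorem map_consW (L : FLab m) (k : Fin (pF m + 1)) (v : WV m) :
    Sum.map π (Gt.perm ρ σ) (consW L k v) = consW (FLab.relabel σ L) k (σ v) := by
  unfold consW; split_ifs <;> rfl

/-- The dead wire is equivariant. [folklore] -/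
theorem map_deadW (L : FLab m) (k : Fin (pF m + 1)) :
    Sum.map π (Gt.perm ρ σ) (deadW L k) = deadW (FLab.relabel σ L) k := by
  unfold deadW; split_ifs <;> rfl

/-- The adjacency wires are equivariant (any input map). [folklore] -/
theorem map_adjWire' (u v : WV m) : Sum.map π (Gt.perm ρ σ) (adjWire u v) = adjWire (σ u) (σ v) := rfl

/-- **Source equivariance of the analysis of stage `k` of the walk of `L`**, for the dispatch
`srcs (.an L k g) = anSrcs L (stIn L k) (.an L k) g`. [folklore] -/
theorem anSrcs_stIn_image (L : FLab m) (k : Fin (pF m + 1)) (g : AnGate m) :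
    (anSrcs L (stIn L k) (fun g => Gt.an L k g) g).image (Sum.map π (Gt.perm ρ σ)) =
      anSrcs (FLab.relabel σ L) (stIn (FLab.relabel σ L) k) (fun g => Gt.an (FLab.relabel σ L) k g) (g.relabel σ) :=
  anSrcs_image _ σ L (stIn L k) (stIn (FLab.relabel σ L) k) _ _ (fun _ => rfl) (map_memW π ρ σ L k)
    (map_valW π ρ σ L k) (map_consW π ρ σ L k) (map_deadW π ρ σ L k) (map_adjWire' π ρ σ) g

/-- **Source equivariance of the transition of stage `k` of the walk of `L`**, for the dispatch
`srcs (.tr L k g) = trSrcs L (stIn L k.castSucc) (.an L k.castSucc) (.tr L k) g`. [folklore] -/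
theorem trSrcs_stIn_image (L : FLab m) (k : Fin (pF m)) (g : TrGate m) :
    (trSrcs L (stIn L k.castSucc) (fun g => Gt.an L k.castSucc g) (fun g => Gt.tr L k g) g).image (Sum.map π (Gt.perm ρ σ)) =
      trSrcs (FLab.relabel σ L) (stIn (FLab.relabel σ L) k.castSucc) (fun g => Gt.an (FLab.relabel σ L) k.castSucc g)
        (fun g => Gt.tr (FLab.relabel σ L) k g) (g.relabel σ) :=
  trSrcs_image _ σ L (stIn L k.castSucc) (stIn (FLab.relabel σ L) k.castSucc) _ _ _ _ (fun _ => rfl) (fun _ => rfl)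
    (map_memW π ρ σ L _) (map_valW π ρ σ L _) (map_consW π ρ σ L _) (map_deadW π ρ σ L _) (map_adjWire' π ρ σ) g

end State

end WCanon

end Summit.PneNP.PneNP.Theorems
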